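import Summits.AtomisticToContinuum.HydrodynamicLimit.Theorems.AprioriBounds.Negative.ExpMomentTangent
import Summits.AtomisticToContinuum.HydrodynamicLimit.Theses.StiffRelaxation
import Literature.Analysis.FluidPDE.HardSphereAlexander

/-!
# `AprioriBounds` (stmt-AtomisticToContinuum-9519) is false modulo `PersistentHotSpot`

Negative lemma MODULO A HYPOTHESIS (refuter cdisprove, cycle 2; resubmitted in cycle 3 after the gate restart
bounced p81988).  The crux `AprioriBounds` claims its two a-priori bounds for EVERY `t > 0` — in particular
after the first singularity of the limiting Euler flow — whereas every mechanism on the table (and the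
conjunct `HydrodynamicLimitFor` itself) lives on the classical interval `[0, T)`.  Component (i) says, block by
block (the tangent bound `tangent_le_expMoment` of `Negative.ExpMomentTangent`), that no mesoscopic block of
mass fraction `m` carries energy per particle above `(2λ)⁻¹ log(C/m)` for most of `[0, t]`.  Gas dynamics
predicts the opposite after the focus of a converging (Guderley) shock: behind the reflected shock the
pressure at the centre stays finite while the deposited entropy diverges toward the centre, so the density
vanishes and the temperature diverges there as power laws, for all later times — a HOT SPOT of unbounded energy
per particle on polynomially small mass.  `PersistentHotSpot` isolates exactly this as a hypothesis (a
space–time law of large numbers on a window toward limit fields with such a hot spot, for SOME admissible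
profile); `AprioriBounds_false_of_PersistentHotSpot` is the kernel-checked deduction
`PersistentHotSpot → ¬ AprioriBounds`.  Nobody can construct `PersistentHotSpot` today (it is a hydrodynamic
limit THROUGH a collapse), so this is NOT a refutation: the item stays open; the lemma records what the
`∀ t > 0` of the crux is exposed to and why every line must conclude the pre-shock form
(`Cruxes/AprioriBounds/Disproof.lean` §6 `AprioriBoundsRepaired`).

Maintenance record (full-build repair, 2026-08-16).  The lemma was stated against the route decl
`CollisionIsometryCLT.AprioriBounds` (stmt-AtomisticToContinuum-9519, the `∀ t > 0` form).  Route rev 12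
(2026-08-16T06:37:12Z, the route choice taken AFTER and BECAUSE OF this negative-lemma hold) retired 9519 and
restated the crux in pre-shock form (`CollisionIsometryCLT.AprioriBoundsPreShock`; in route
`StiffCollisionalRelaxation` the name `AprioriBounds` now denotes the same pre-shock restatement, stmt-14827), after
which `CollisionIsometryCLT.AprioriBounds` no longer resolves.  The retired `∀ t > 0` statement survives in the
tree VERBATIM (token-identical to the ledger signature of stmt-9519) as the gate-written decl
`StiffRelaxation.AprioriBounds` (stmt-AtomisticToContinuum-7231, route `StiffRelaxation`), so the `open` below is
re-pointed there: same proposition, same proof, same lemma name (the ledger's hold record of 9519 names it).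
-/

noncomputable section

open MeasureTheory Filter Set Topology
open scoped ENNReal

namespace Summit.AtomisticToContinuum.HydrodynamicLimit.Theorems.AprioriBoundsNegative

open Literature.MathematicalPhysics.KineticTheory Literature.Analysis.FluidPDE
-- re-pointed 2026-08-16 from `…Theses.CollisionIsometryCLT (AprioriBounds)` (stmt-9519, retired at route rev 12)
-- to the token-identical retired-route decl (stmt-7231); see the maintenance record in the module docstring.
open Summit.AtomisticToContinuum.HydrodynamicLimit.Theses.StiffRelaxation (AprioriBounds)

/-- **H = `PersistentHotSpot`** (HYPOTHESIS of a negative lemma — deliberately NOT tagged as a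
literature fact: nobody has proved it for hard spheres; it is what gas dynamics predicts after the
focus of a converging shock.  Sources for the gas-dynamical picture: G. Guderley, Luftfahrtforschung
19 (1942) 302–312; Zel'dovich–Raizer, Physics of Shock Waves (2002), Ch. XII §§5–9, PDF pp. 860–863
(bib key ZeldovichEtAl2002, held, page-read by the crux ideators); P. L. Sachdev, Shock Waves and
Explosions (2004), §6.1 p. 190 and §3.8 p. 137; R. B. Lazarus, SIAM J. Numer. Anal. 18 (1981)
316–371.)
For SOME admissible profiles `(a₀, θ₀, u₀)` (continuous, `a₀, θ₀ > 0`) there is `σ₁ > 0` such that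
for all `0 < σ < σ₁` and every hard-sphere flow family `Φ` there are a window `0 ≤ t₁ < t₂` and
window-integrated limit fields `ρI, EI : 𝕋³ → ℝ` (mass, energy) with
(1) SPACE–TIME LAW OF LARGE NUMBERS: for every continuous `χ` and `δ > 0`, under the local Gibbs
laws the window integrals `∫_{t₁}^{t₂} (N+1)⁻¹∑ᵢ χ(xᵢ(s)) ds` and
`∫_{t₁}^{t₂} (N+1)⁻¹∑ᵢ χ(xᵢ(s))|vᵢ(s)|²/2 ds` are `δ`-close to `∫ χ ρI`, `∫ χ EI` with probability
`→ 1`; (2) HOT SPOT: for every `λ > 0` the perspective functional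
`χ ↦ (∫χρI) · exp(2λ ∫χEI / ∫χρI)` is unbounded over continuous `0 ≤ χ ≤ 1` with `∫χρI > 0`
(e.g. `∫_{B_R(x⋆)} ρI ≍ R^{3+κ}`, `∫_{B_R(x⋆)} EI ≍ R³`, `κ > 0`: unbounded energy per particle on a
polynomially small mass).  This is what gas dynamics predicts after the focus of a converging
(Guderley) shock: behind the reflected shock the pressure at the centre is finite while the entropy
deposited diverges toward the centre, so `ρ → 0` and `θ → ∞` as power laws at the focal point for all
later times.  Nobody can prove (1) for deterministic hard spheres (it is a hydrodynamic limit THROUGH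
a collapse); the hypothesis isolates exactly what the `∀ t > 0` of the crux is exposed to. -/
def PersistentHotSpot : Prop :=
  ∃ (a₀ θ₀ : T3 → ℝ) (u₀ : T3 → V3), Continuous a₀ ∧ Continuous θ₀ ∧ Continuous u₀ ∧
    (∀ x, 0 < a₀ x) ∧ (∀ x, 0 < θ₀ x) ∧
    ∃ σ₁ : ℝ, 0 < σ₁ ∧ ∀ σ : ℝ, 0 < σ → σ < σ₁ →
      ∀ Φ : (N : ℕ) → HardSphereFlow (Torus.geometry (Fin 3)) (hsDiameter σ N) (N + 1),
        ∃ t₁ t₂ : ℝ, 0 ≤ t₁ ∧ t₁ < t₂ ∧ ∃ ρI EI : T3 → ℝ,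
          (∀ χ : T3 → ℝ, Continuous χ → ∀ δ : ℝ, 0 < δ →
            Tendsto (fun N : ℕ => localGibbsLaw σ a₀ u₀ θ₀ N (Φ N)
              {z | δ < |(∫ s in Icc t₁ t₂, empiricalDensityField ((Φ N).flow s z) χ) -
                ∫ x, χ x * ρI x|}) atTop (𝓝 0) ∧
            Tendsto (fun N : ℕ => localGibbsLaw σ a₀ u₀ θ₀ N (Φ N)
              {z | δ < |(∫ s in Icc t₁ t₂, empiricalEnergyField ((Φ N).flow s z) χ) -
                ∫ x, χ x * EI x|}) atTop (𝓝 0)) ∧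
          (∀ lam : ℝ, 0 < lam → ∀ L : ℝ, ∃ χ : T3 → ℝ, Continuous χ ∧ (∀ x, 0 ≤ χ x) ∧
            (∀ x, χ x ≤ 1) ∧ 0 < ∫ x, χ x * ρI x ∧
            L ≤ (∫ x, χ x * ρI x) * Real.exp (2 * lam * (∫ x, χ x * EI x) / ∫ x, χ x * ρI x))

/-- **Hot-spot criterion.**  If the energy per unit mass blows up polynomially in the inverse mass,
`e/m ≥ c · m^{-p}` (`c, p > 0`), then the perspective functional `m · exp(2λ e/m)` exceeds every `L`
once the mass `m > 0` is small enough — for EVERY `λ > 0`.  (E.g. Guderley / Taylor–Sedov centre: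
mass `≍ R^{3+κ}` and energy `≍ R³` in the ball `B_R`, so `e/m ≍ m^{-κ/(3+κ)}`.) -/
theorem perspective_ge_of_small_mass {lam c p : ℝ} (hlam : 0 < lam) (hc : 0 < c) (hp : 0 < p)
    (L : ℝ) : ∃ m₀ : ℝ, 0 < m₀ ∧ ∀ m e : ℝ, 0 < m → m ≤ m₀ → c * m ^ (-p) ≤ e / m →
      L ≤ m * Real.exp (2 * lam * e / m) := by
  -- an integer `k` with `k p > 1`
  obtain ⟨k, hk⟩ : ∃ k : ℕ, 1 < (k : ℝ) * p := by
    obtain ⟨k, hk⟩ := exists_nat_gt (1 / p)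
    exact ⟨k, by rwa [div_lt_iff₀ hp] at hk⟩
  set q : ℝ := (k : ℝ) * p - 1 with hq
  have hq0 : 0 < q := by rw [hq]; linarith
  set A : ℝ := (2 * lam * c) ^ k / (k.factorial : ℝ) with hA
  have hA0 : 0 < A := by rw [hA]; positivity
  -- the threshold
  by_cases hL : L ≤ 0
  · refine ⟨1, one_pos, fun m e hm _ _ => hL.trans ?_⟩
    positivity
  push Not at hL
  set m₀ : ℝ := (A / L) ^ (1 / q) with hm₀
  have hAL : 0 < A / L := div_pos hA0 hL
  have hm₀0 : 0 < m₀ := by rw [hm₀]; exact Real.rpow_pos_of_pos hAL _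
  refine ⟨m₀, hm₀0, fun m e hm hmm₀ hem => ?_⟩
  -- lower bound on the exponent
  set y₀ : ℝ := 2 * lam * c * m ^ (-p) with hy₀
  have hy₀0 : 0 ≤ y₀ := by rw [hy₀]; positivity
  have hy : y₀ ≤ 2 * lam * e / m := by
    rw [hy₀]
    have : 2 * lam * e / m = 2 * lam * (e / m) := by ring
    rw [this, mul_assoc]
    exact mul_le_mul_of_nonneg_left hem (by positivity)
  have hexp : y₀ ^ k / (k.factorial : ℝ) ≤ Real.exp (2 * lam * e / m) :=
    (Real.pow_div_factorial_le_exp y₀ hy₀0 k).trans (Real.exp_le_exp.2 hy)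
  -- `m · y₀^k / k! = A · m^{-q}`
  have hpow : m * (y₀ ^ k / (k.factorial : ℝ)) = A * m ^ (-q) := by
    rw [hy₀, hA, mul_pow, ← Real.rpow_mul_natCast hm.le]
    have h1 : m * (m ^ (-p * (k : ℝ))) = m ^ (-q) := by
      rw [hq, ← Real.rpow_one_add' hm.le]
      · congr 1; ring
      · rw [hq] at hq0; linarith
    calc m * ((2 * lam * c) ^ k * m ^ (-p * (k : ℝ)) / (k.factorial : ℝ))
        = (2 * lam * c) ^ k / (k.factorial : ℝ) * (m * m ^ (-p * (k : ℝ))) := by ring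
      _ = (2 * lam * c) ^ k / (k.factorial : ℝ) * m ^ (-q) := by rw [h1]
  -- monotonicity of `m ↦ m^{-q}`
  have hmono : m₀ ^ (-q) ≤ m ^ (-q) := Real.rpow_le_rpow_of_nonpos hm hmm₀ (by linarith)
  have hm₀q : m₀ ^ (-q) = L / A := by
    rw [hm₀, ← Real.rpow_mul hAL.le]
    have : 1 / q * -q = -1 := by field_simp
    rw [this, Real.rpow_neg_one, inv_div]
  calc L = A * (L / A) := by field_simp
    _ = A * m₀ ^ (-q) := by rw [hm₀q]
    _ ≤ A * m ^ (-q) := mul_le_mul_of_nonneg_left hmono hA0.le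
    _ = m * (y₀ ^ k / (k.factorial : ℝ)) := hpow.symm
    _ ≤ m * Real.exp (2 * lam * e / m) := mul_le_mul_of_nonneg_left hexp hm.le

/-- **Negative lemma modulo `PersistentHotSpot`.**  If the hard-sphere gas does, after the focus of
a converging shock, what gas dynamics predicts (space–time LLN toward a limit with a hot spot of
unbounded energy per particle on polynomially small mass), then `AprioriBounds` is FALSE: its
component (i) claims, for every `t > 0` — after the collapse time too — some `λ > 0` and `C` with
`P_N{C < ∫₀ᵗ (N+1)⁻¹∑ᵢ e^{λ|vᵢ(s)|²} ds} → 0`, while the hot spot forces this probability `→ 1` for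
every `λ > 0` and every `C` (pathwise tangent bound `expMoment_window_gt` + the LLN).  REPAIR (the
witness misses it): restrict `t` to `t < T`, `T` the classical existence time of the hard-sphere
Euler solution issued from the data (`AprioriBoundsRepaired`, Disproof.lean §6), exactly as the
conjunct `HydrodynamicLimitFor` does. -/
theorem AprioriBounds_false_of_PersistentHotSpot : PersistentHotSpot → ¬ AprioriBounds := by
  rintro ⟨a₀, θ₀, u₀, ha, hθ, hu, ha0, hθ0, σ₁, hσ₁, hH⟩ hAB
  obtain ⟨σ₀, hσ₀, hA⟩ := hAB a₀ θ₀ u₀ ha hθ hu ha0 hθ0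
  -- a common small reduced density
  have hmin : 0 < min (min σ₀ σ₁) (1 / 2) := lt_min (lt_min hσ₀ hσ₁) (by norm_num)
  set σ : ℝ := min (min σ₀ σ₁) (1 / 2) / 2 with hσdef
  have hσ : 0 < σ := half_pos hmin
  have hσlt : σ < min (min σ₀ σ₁) (1 / 2) := half_lt_self hmin
  have hσσ₀ : σ < σ₀ := hσlt.trans_le ((min_le_left _ _).trans (min_le_left _ _))
  have hσσ₁ : σ < σ₁ := hσlt.trans_le ((min_le_left _ _).trans (min_le_right _ _))
  have hσ2 : σ < 1 / 2 := hσlt.trans_le (min_le_right _ _)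
  -- a flow family (Alexander's theorem; any other would do, flows agree a.e.)
  set Φ : (N : ℕ) → HardSphereFlow (Torus.geometry (Fin 3)) (hsDiameter σ N) (N + 1) :=
    fun N => Alexander.regHardSphereFlow (d := Fin 3) (hsDiameter_pos hσ N)
      ((hsDiameter_le hσ.le N).trans_lt (by linarith)) (N + 1) with hΦ
  obtain ⟨t₁, t₂, ht₁, ht₁₂, ρI, EI, hconv, hhot⟩ := hH σ hσ hσσ₁ Φ
  have ht₂ : 0 < t₂ := ht₁.trans_lt ht₁₂
  obtain ⟨lam, Cexp, hlam, hT⟩ := (hA σ hσ hσσ₀ Φ t₂ ht₂).1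
  obtain ⟨χ, hχc, hχ0, hχ1, hM, hL⟩ := hhot lam hlam (Cexp + 2)
  set M : ℝ := ∫ x, χ x * ρI x with hMdef
  set E : ℝ := ∫ x, χ x * EI x with hEdef
  set K : ℝ := Real.exp (2 * lam * E / M) * (|1 - 2 * lam * E / M| + 2 * lam) with hK
  have hK0 : 0 < K := by positivity
  set δ : ℝ := K⁻¹ with hδdef
  have hδ0 : 0 < δ := by positivity
  have hδK : δ * K ≤ 1 := by rw [hδdef, inv_mul_cancel₀ hK0.ne']
  obtain ⟨hB1, hB2⟩ := hconv χ hχc δ hδ0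
  -- the events
  set P : (N : ℕ) → Measure (Config (N + 1) (Fin 3) T3) :=
    fun N => localGibbsLaw σ a₀ u₀ θ₀ N (Φ N) with hPdef
  set A : (N : ℕ) → Set (Config (N + 1) (Fin 3) T3) := fun N =>
    {z | Cexp < ∫ s in Icc 0 t₂, ∫ y, Real.exp (lam * ‖y.2‖ ^ 2)
      ∂(empiricalMeasure ((Φ N).flow s z))} with hAdef
  set B1 : (N : ℕ) → Set (Config (N + 1) (Fin 3) T3) := fun N =>
    {z | δ < |(∫ s in Icc t₁ t₂, empiricalDensityField ((Φ N).flow s z) χ) - M|} with hB1def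
  set B2 : (N : ℕ) → Set (Config (N + 1) (Fin 3) T3) := fun N =>
    {z | δ < |(∫ s in Icc t₁ t₂, empiricalEnergyField ((Φ N).flow s z) χ) - E|} with hB2def
  have hcover : ∀ N, (univ : Set (Config (N + 1) (Fin 3) T3)) ⊆
      A N ∪ B1 N ∪ B2 N ∪ ((Φ N).good)ᶜ := by
    intro N z _
    by_cases hz : z ∈ (Φ N).good
    · by_cases h1 : δ < |(∫ s in Icc t₁ t₂, empiricalDensityField ((Φ N).flow s z) χ) - M|
      · exact Or.inl (Or.inl (Or.inr h1))
      by_cases h2 : δ < |(∫ s in Icc t₁ t₂, empiricalEnergyField ((Φ N).flow s z) χ) - E|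
      · exact Or.inl (Or.inr h2)
      refine Or.inl (Or.inl (Or.inl ?_))
      exact expMoment_window_gt (Φ N) hz hlam hχc hχ0 hχ1 ht₁ hM hL hδK
        (not_lt.1 h1) (not_lt.1 h2)
    · exact Or.inr hz
  have hbound : ∀ N, (1 : ℝ≥0∞) ≤ P N (A N) + P N (B1 N) + P N (B2 N) := by
    intro N
    haveI := isProbabilityMeasure_localGibbsLaw ha hθ hu ha0 hθ0 hσ2.le N (Φ N)
    have hg : P N ((Φ N).good)ᶜ = 0 := by
      rw [hPdef]
      show localGibbsLaw σ a₀ u₀ θ₀ N (Φ N) ((Φ N).good)ᶜ = 0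
      rw [localGibbsLaw_eq]
      exact localGibbsMeasure_absolutelyContinuous σ a₀ u₀ θ₀ N (Φ N) (Φ N).measure_compl_good
    calc (1 : ℝ≥0∞) = P N univ := measure_univ.symm
      _ ≤ P N (A N ∪ B1 N ∪ B2 N ∪ ((Φ N).good)ᶜ) := measure_mono (hcover N)
      _ ≤ P N (A N ∪ B1 N ∪ B2 N) + P N ((Φ N).good)ᶜ := measure_union_le _ _
      _ ≤ P N (A N ∪ B1 N) + P N (B2 N) + P N ((Φ N).good)ᶜ :=
          add_le_add (measure_union_le _ _) le_rfl
      _ ≤ P N (A N) + P N (B1 N) + P N (B2 N) + P N ((Φ N).good)ᶜ :=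
          add_le_add (add_le_add (measure_union_le _ _) le_rfl) le_rfl
      _ = P N (A N) + P N (B1 N) + P N (B2 N) := by rw [hg, add_zero]
  have hlim : Tendsto (fun N => P N (A N) + P N (B1 N) + P N (B2 N)) atTop (𝓝 0) := by
    have := (hT.add hB1).add hB2
    simpa using this
  have h10 : (1 : ℝ≥0∞) ≤ 0 := ge_of_tendsto' hlim hbound
  exact absurd h10 (by norm_num)


end Summit.AtomisticToContinuum.HydrodynamicLimit.Theorems.AprioriBoundsNegative

end
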